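import Summits.QuantumFields.YangMills.Theorems.LuscherReductionDressedRitzOfOperatorPlateau
import Summits.QuantumFields.YangMills.Theorems.LuscherReductionDressedRitzPlateauCertificates
import Summits.QuantumFields.YangMills.Theorems.LuscherReductionTraceDoorBasics
import HarnessLib

/-!
# Route `LuscherReduction`, item `DressedRitz` (stmt-QuantumFields-20205) — reduction chain, file 7: the SPREAD clauses (x7) ∕ (o7) are REDUNDANT
# (crux ONE is closed): `ExcitedPlateauAt k` and `OperatorPlateauAt k` from their first six clauses

Support module of the `FemtoTransferGap` group (fleet service by seat ym-infvol-p2 g6; route `LuscherReduction`, femto rung R2b1; bears on the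
crux child `DressedRitz` = stmt-QuantumFields-20205 of RED stmt-QuantumFields-19978).  NEW (not in the planner's workfiles): one clause of each typed
cut is struck from the prover's list.

WHY IT IS FREE.  Clause (x7) of `KTGen.ExcitedPlateauAt k` asks `λ₀ − d_i ≤ C(λ/L)λ₀` for the excited diagonal values `d_i = ⟨w_i, K_β w_i⟩`; clause
(o7) of `OpPlat.PlateauClauses` is its homogeneous form `λ₀ n_i − d_ii ≤ C(λ/L)λ₀ n_i`.  But the LOWER half of the Lüscher position (x5) ∕ (o5),
`μ_{i+1} λ₀ (n_i) ≤ e^{Cλ²/L} d_i μ₀`, together with the COARSE ONE-SITE LOWER LAW `e^{−(Δ_j+1)λ_b} μ₀ ≤ μ_j` (`TraceDoor.oneSiteLowerCoarse`, i.e.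
the route's crux ONE `OneSiteLevels`, stmt-QuantumFields-20007, CLOSED 2026-08-27 by `oneSiteLevels_proof`; `λ_b = λ/L` by
`bareLambda_oneSiteCoupling`) gives `d_i ≥ e^{−Cλ²/L − (Δ_{i+1}+1)λ/L} λ₀ (n_i)`, whence `λ₀ − d_i ≤ (|C| + Δ_k + 1)(λ/L)λ₀` deep in the window
(`λ ≤ 2·lam ≤ 1`, `B(β,L) ≥ B₀` by `oneSiteCoupling_ge_of_small_level`) — the pure-real step is the certificate lemma `spread_le_of_red_one`.
So a prover of item 20205 through these cuts delivers (x1)–(x6) ∕ (o0)–(o6) only.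

* `spread_of_position` — the pointwise step (homogeneous weight `n ≥ 0`).
* `plateauClauses_of_core` — (o0)–(o6) ⇒ `PlateauClauses k (|C| + levelGap k + 1) β u` deep in the window.
* ★ `excitedPlateauAt_of_core : (ExcitedPlateauAt k minus (x7)) → ExcitedPlateauAt k`;
  ★ `operatorPlateauAt_of_core : (OperatorPlateauAt k with PlateauClauses minus (o7)) → OperatorPlateauAt k`;
  `dressedRitzAt_of_excitedCore`, `dressedRitzAt_of_operatorCore`, and the route decl from the cores at every `k`.
(The "core" hypotheses are spelled out inline — no further definitions.)

HONEST FRAMING: fixed-lattice ∕ pure-real bookkeeping on the femto rung R2b1 using the closed crux ONE; proves nothing OF `DressedRitz` (the XL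
estimate); no bearing on infinite volume, the continuum limit or the Clay mass gap.  References: M. Lüscher, NPB 219 (1983) 233 [cite: Luscher1983, §3];
Reed–Simon IV, Thm. XIII.1 [cite: ReedSimonIV1978, Thm. XIII.1].
-/

set_option autoImplicit false

noncomputable section

open MeasureTheory Filter Topology Real
open Literature.MathematicalPhysics.QuantumFieldTheory
open Literature.MathematicalPhysics.QuantumLattice
open Literature.Analysis.OperatorTheory.YMMatrixModel
open scoped BigOperators

namespace Summit.QuantumFields.YangMills.Theorems.FemtoTransferGap.KTGen

open Summit.QuantumFields.YangMills.Theorems.FemtoTransferGap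
open Summit.QuantumFields.YangMills.Theorems.FemtoTransferGap.KTRCalibration
open Summit.QuantumFields.YangMills.Theorems.FemtoTransferGap.PhysL2
open Summit.QuantumFields.YangMills.Theorems.FemtoTransferGap.OpPlat
open Summit.QuantumFields.YangMills.Theorems.FemtoTransferGap.TraceDoor

/-! ## §1 The pointwise step -/

/-- **(x7) ∕ (o7) from the lower Lüscher position and the coarse one-site lower law** (homogeneous weight `n ≥ 0`): if `B(β,L) ≥ B₀` where the
coarse law `e^{−(Δ_j+1)λ_b}μ₀ ≤ μ_j` (`j ≤ k`) holds, `λ = λ(β,L) ∈ (0, 1]`, and `μ_i λ₀ n ≤ e^{Cλ²/L} d μ₀` for some `i ≤ k`, then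
`λ₀ n − d ≤ (|C| + Δ_k + 1)(λ/L)(λ₀ n)`. [cite: Luscher1983, §3] -/
theorem spread_of_position {k i : ℕ} (hi : i ≤ k) {B0 C β : ℝ} {L : ℕ} [NeZero L]
    (hB0 : ∀ B : ℝ, B0 ≤ B → 0 < levelValue su2Rep 1 B 0 ∧
      ∀ j : ℕ, j ≤ k → Real.exp (-((levelGap j + 1) * bareLambda B)) * levelValue su2Rep 1 B 0 ≤ levelValue su2Rep 1 B j)
    (hB : B0 ≤ oneSiteCoupling β L) (hβ : 0 ≤ β) (hlpos : 0 < luscherLambda β L) (hl1 : luscherLambda β L ≤ 1)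
    {d n : ℝ} (hn : 0 ≤ n)
    (h5 : levelValue su2Rep 1 (oneSiteCoupling β L) i * levelValue su2Rep L β 0 * n ≤
      Real.exp (C * luscherLambda β L ^ 2 / L) * (d * levelValue su2Rep 1 (oneSiteCoupling β L) 0)) :
    levelValue su2Rep L β 0 * n - d ≤ (|C| + levelGap k + 1) * (luscherLambda β L / L) * (levelValue su2Rep L β 0 * n) := by
  obtain ⟨hμ0, hlow⟩ := hB0 _ hB
  have hL1 : (1 : ℝ) ≤ (L : ℝ) := by exact_mod_cast NeZero.one_le
  have hl0 : 0 ≤ levelValue su2Rep L β 0 * n := mul_nonneg (levelValue_su2Rep_nonneg L hβ 0) hn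
  have hONE : Real.exp (-((levelGap i + 1) * (luscherLambda β L / L) + 0 * (luscherLambda β L / L) ^ 2)) *
      levelValue su2Rep 1 (oneSiteCoupling β L) 0 ≤ levelValue su2Rep 1 (oneSiteCoupling β L) i := by
    have h := hlow i hi
    rw [bareLambda_oneSiteCoupling hlpos] at h
    simpa only [zero_mul, add_zero] using h
  have hRED : levelValue su2Rep 1 (oneSiteCoupling β L) i * (levelValue su2Rep L β 0 * n) ≤
      Real.exp (C * luscherLambda β L ^ 2 / L) * (d * levelValue su2Rep 1 (oneSiteCoupling β L) 0) := by
    rw [← mul_assoc]; exact h5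
  have h := spread_le_of_red_one (C := C) (D := levelGap i + 1) (C1 := 0) hμ0 hl0 hlpos.le hl1 hL1 hONE hRED
  have hgap : |levelGap i + 1| ≤ levelGap k + 1 := by
    rw [abs_of_nonneg (by linarith [levelGap_nonneg i])]
    linarith [levelGap_mono hi]
  have ht : 0 ≤ luscherLambda β L / L := div_nonneg hlpos.le (Nat.cast_nonneg L)
  calc levelValue su2Rep L β 0 * n - d
      ≤ (|C| + |levelGap i + 1| + |(0 : ℝ)|) * (luscherLambda β L / L) * (levelValue su2Rep L β 0 * n) := h
    _ ≤ (|C| + levelGap k + 1) * (luscherLambda β L / L) * (levelValue su2Rep L β 0 * n) := by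
        apply mul_le_mul_of_nonneg_right _ hl0
        apply mul_le_mul_of_nonneg_right _ ht
        rw [abs_zero, add_zero]
        linarith

/-! ## §2 `PlateauClauses` from its first six clauses -/

/-- **(o0)–(o6) ⇒ `PlateauClauses`** with constant `C' = |C| + Δ_k + 1`, deep in the window (`B(β,L) ≥ B₀` of the coarse one-site law,
`λ ∈ (0,1]`): (o7) is `spread_of_position`; the other clauses are monotone in the constant (for (o5) note `d_ii ≥ 0` is forced by (o5) itself,
`μ₀ > 0`). [cite: Luscher1983, §3] -/
theorem plateauClauses_of_core {k : ℕ} {B0 C β : ℝ} {L : ℕ} [NeZero L] {u : Fin k → (GaugeConfig 3 L SU2 → ℝ)}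
    (hB0 : ∀ B : ℝ, B0 ≤ B → 0 < levelValue su2Rep 1 B 0 ∧
      ∀ j : ℕ, j ≤ k → Real.exp (-((levelGap j + 1) * bareLambda B)) * levelValue su2Rep 1 B 0 ≤ levelValue su2Rep 1 B j)
    (hB : B0 ≤ oneSiteCoupling β L) (hβ : 0 ≤ β) (hlpos : 0 < luscherLambda β L) (hl1 : luscherLambda β L ≤ 1)
    (h0 : ∀ i : Fin k, 0 < l2 (u i) (u i))
    (h1 : ∀ i l : Fin k, i ≤ l →
      l2 (u l) (transferApply β (u l)) * l2 (u i) (u i) ≤ l2 (u i) (transferApply β (u i)) * l2 (u l) (u l))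
    (h2 : ∀ i l : Fin k, i ≠ l →
      |l2 (u i) (u l)| ≤ C * luscherLambda β L * (Real.sqrt (l2 (u i) (u i)) * Real.sqrt (l2 (u l) (u l))))
    (h4 : ∀ i : Fin k,
      l2 (transferApply β (u i)) (transferApply β (u i)) * l2 (u i) (u i) - l2 (u i) (transferApply β (u i)) ^ 2
        ≤ C * (luscherLambda β L ^ 3 / (L : ℝ) ^ 2) * levelValue su2Rep L β 0 ^ 2 * l2 (u i) (u i) ^ 2)
    (h5 : ∀ i : Fin k,
      l2 (u i) (transferApply β (u i)) * levelValue su2Rep 1 (oneSiteCoupling β L) 0 ≤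
          Real.exp (C * luscherLambda β L ^ 2 / L) *
            (levelValue su2Rep 1 (oneSiteCoupling β L) ((i : ℕ) + 1) * levelValue su2Rep L β 0) * l2 (u i) (u i) ∧
      levelValue su2Rep 1 (oneSiteCoupling β L) ((i : ℕ) + 1) * levelValue su2Rep L β 0 * l2 (u i) (u i) ≤
          Real.exp (C * luscherLambda β L ^ 2 / L) *
            (l2 (u i) (transferApply β (u i)) * levelValue su2Rep 1 (oneSiteCoupling β L) 0))
    (h6 : ∀ i l : Fin k, i ≠ l →
      |l2 (u i) (transferApply β (u l)) -
          (l2 (u i) (transferApply β (u i)) / l2 (u i) (u i) + l2 (u l) (transferApply β (u l)) / l2 (u l) (u l)) / 2 *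
            l2 (u i) (u l)|
        ≤ C * (luscherLambda β L ^ 2 / L) * levelValue su2Rep L β 0 *
            (Real.sqrt (l2 (u i) (u i)) * Real.sqrt (l2 (u l) (u l)))) :
    PlateauClauses k (|C| + levelGap k + 1) β u := by
  set C' : ℝ := |C| + levelGap k + 1 with hC'def
  have hgk : 0 ≤ levelGap k := levelGap_nonneg k
  have hCC' : C ≤ C' := by rw [hC'def]; linarith [le_abs_self C]
  have hμ0 : 0 < levelValue su2Rep 1 (oneSiteCoupling β L) 0 := (hB0 _ hB).1
  have hlam_nn : 0 ≤ luscherLambda β L := hlpos.le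
  have hLnn : (0 : ℝ) ≤ (L : ℝ) := Nat.cast_nonneg L
  have ht1 : 0 ≤ luscherLambda β L / L := div_nonneg hlam_nn hLnn
  have ht2 : 0 ≤ luscherLambda β L ^ 2 / L := div_nonneg (sq_nonneg _) hLnn
  have ht3 : 0 ≤ luscherLambda β L ^ 3 / (L : ℝ) ^ 2 := div_nonneg (pow_nonneg hlam_nn 3) (sq_nonneg _)
  have hlv0 : 0 ≤ levelValue su2Rep L β 0 := levelValue_su2Rep_nonneg L hβ 0
  have hB' : 0 ≤ oneSiteCoupling β L := oneSiteCoupling_nonneg β L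
  have hsq : ∀ i l : Fin k, 0 ≤ Real.sqrt (l2 (u i) (u i)) * Real.sqrt (l2 (u l) (u l)) := fun i l =>
    mul_nonneg (Real.sqrt_nonneg _) (Real.sqrt_nonneg _)
  refine ⟨h0, h1, fun i l hil => ?_, fun i => ?_, fun i => ?_, fun i l hil => ?_, fun i => ?_⟩
  · exact (h2 i l hil).trans (mul_le_mul_of_nonneg_right (mul_le_mul_of_nonneg_right hCC' hlam_nn) (hsq i l))
  · exact (h4 i).trans (mul_le_mul_of_nonneg_right
      (mul_le_mul_of_nonneg_right (mul_le_mul_of_nonneg_right hCC' ht3) (sq_nonneg _)) (sq_nonneg _))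
  · obtain ⟨ha, hb⟩ := h5 i
    have hY₁ : 0 ≤ levelValue su2Rep 1 (oneSiteCoupling β L) ((i : ℕ) + 1) * levelValue su2Rep L β 0 :=
      mul_nonneg (levelValue_su2Rep_nonneg 1 hB' _) hlv0
    have hY₁n : 0 ≤ levelValue su2Rep 1 (oneSiteCoupling β L) ((i : ℕ) + 1) * levelValue su2Rep L β 0 * l2 (u i) (u i) :=
      mul_nonneg hY₁ (h0 i).le
    -- `d_ii ≥ 0` is forced by (o5) itself: the left side of `hb` is `≥ 0`, so `e^{…}·(d_ii μ₀) ≥ 0`, and `μ₀ > 0`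
    have hd : 0 ≤ l2 (u i) (transferApply β (u i)) := by
      by_contra hneg
      push Not at hneg
      have hlt : Real.exp (C * luscherLambda β L ^ 2 / L) *
          (l2 (u i) (transferApply β (u i)) * levelValue su2Rep 1 (oneSiteCoupling β L) 0) < 0 :=
        mul_neg_of_pos_of_neg (Real.exp_pos _) (mul_neg_of_neg_of_pos hneg hμ0)
      linarith
    have hY₂ : 0 ≤ l2 (u i) (transferApply β (u i)) * levelValue su2Rep 1 (oneSiteCoupling β L) 0 :=
      mul_nonneg hd hμ0.le
    refine ⟨?_, le_exp_mul_div_of_le hb ht2 hY₂ hCC'⟩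
    rw [mul_assoc] at ha ⊢
    exact le_exp_mul_div_of_le ha ht2 hY₁n hCC'
  · exact (h6 i l hil).trans (mul_le_mul_of_nonneg_right
      (mul_le_mul_of_nonneg_right (mul_le_mul_of_nonneg_right hCC' ht2) hlv0) (hsq i l))
  · have h := spread_of_position (Nat.succ_le_of_lt i.2) hB0 hB hβ hlpos hl1 (h0 i).le (h5 i).2
    calc levelValue su2Rep L β 0 * l2 (u i) (u i) - l2 (u i) (transferApply β (u i))
        ≤ (|C| + levelGap k + 1) * (luscherLambda β L / L) * (levelValue su2Rep L β 0 * l2 (u i) (u i)) := h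
      _ = C' * (luscherLambda β L / L) * levelValue su2Rep L β 0 * l2 (u i) (u i) := by rw [hC'def]; ring

/-! ## §3 The cuts from their cores (deep window via the coarse one-site law = crux ONE, closed) -/

/-- ★ **`ExcitedPlateauAt k` from (x1)–(x6)**: the spread clause (x7) is implied by the lower Lüscher position (x5) and the closed crux ONE.
Output constant `|C| + Δ_k + 1`, threshold `min lam0 (min (1/2) (1/(4·max B₀ 1)))`. [cite: Luscher1983, §3] -/
theorem excitedPlateauAt_of_core {k : ℕ}
    (h : ∃ C lam0 : ℝ, 0 < lam0 ∧ ∀ lam : ℝ, 0 < lam → lam ≤ lam0 → ∃ L0 : ℕ,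
      ∀ (L : ℕ) [NeZero L], L0 ≤ L → ∀ β : ℝ, InFemtoWindow lam β L →
        ∃ w : Fin k → (GaugeConfig 3 L SU2 → ℝ),
          (∀ i, IsPhys (w i)) ∧ (∀ i, l2 (w i) (w i) = 1) ∧
          (∀ i l : Fin k, i ≤ l → qform su2Rep β (w l) (w l) ≤ qform su2Rep β (w i) (w i)) ∧
          (∀ i l : Fin k, i ≠ l → |l2 (w i) (w l)| ≤ C * luscherLambda β L) ∧
          (∃ φ : GaugeConfig 3 L SU2 → ℝ, IsPhys φ ∧ l2 φ φ = 1 ∧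
              transferApply β φ = levelValue su2Rep L β 0 • φ ∧ ∀ i, |l2 φ (w i)| ≤ C * luscherLambda β L) ∧
          (∀ i, l2 (transferApply β (w i) - qform su2Rep β (w i) (w i) • w i)
              (transferApply β (w i) - qform su2Rep β (w i) (w i) • w i)
              ≤ C * (luscherLambda β L ^ 3 / (L : ℝ) ^ 2) * levelValue su2Rep L β 0 ^ 2) ∧
          (∀ i : Fin k,
            qform su2Rep β (w i) (w i) * levelValue su2Rep 1 (oneSiteCoupling β L) 0 ≤
                Real.exp (C * luscherLambda β L ^ 2 / L) *
                  (levelValue su2Rep 1 (oneSiteCoupling β L) ((i : ℕ) + 1) * levelValue su2Rep L β 0) ∧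
            levelValue su2Rep 1 (oneSiteCoupling β L) ((i : ℕ) + 1) * levelValue su2Rep L β 0 ≤
                Real.exp (C * luscherLambda β L ^ 2 / L) *
                  (qform su2Rep β (w i) (w i) * levelValue su2Rep 1 (oneSiteCoupling β L) 0)) ∧
          (∀ i l : Fin k, i ≠ l →
            |qform su2Rep β (w i) (w l) - (qform su2Rep β (w i) (w i) + qform su2Rep β (w l) (w l)) / 2 * l2 (w i) (w l)|
              ≤ C * (luscherLambda β L ^ 2 / L) * levelValue su2Rep L β 0)) :
    ExcitedPlateauAt k := by
  obtain ⟨C, lam0, hlam0, hC⟩ := h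
  obtain ⟨B0, hB0⟩ := oneSiteLowerCoarse k 1 one_pos
  set C' : ℝ := |C| + levelGap k + 1 with hC'def
  have hgk : 0 ≤ levelGap k := levelGap_nonneg k
  have hCC' : C ≤ C' := by rw [hC'def]; linarith [le_abs_self C]
  refine ⟨C', min lam0 (min (1 / 2) (1 / (4 * max B0 1))), lt_min hlam0 (lt_min (by norm_num) (by positivity)),
    fun lam hlam hle => ?_⟩
  obtain ⟨L0, hL⟩ := hC lam hlam (hle.trans (min_le_left _ _))
  refine ⟨L0, fun L _ hL0 β hW => ?_⟩
  obtain ⟨w, hw, hunit, hanti, horth, ⟨φ, hφ, hφ1, hKφ, hvac⟩, hres, hlus, hcoup⟩ := hL L hL0 β hW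
  have hlam_half : lam ≤ 1 / 2 := (hle.trans (min_le_right _ _)).trans (min_le_left _ _)
  have hlam1 : lam ≤ 1 := hlam_half.trans (by norm_num)
  have hlamB : lam ≤ 1 / (4 * max B0 1) := (hle.trans (min_le_right _ _)).trans (min_le_right _ _)
  have hβ : (0 : ℝ) ≤ β := zero_le_one.trans hW.1
  have hB : B0 ≤ oneSiteCoupling β L := oneSiteCoupling_ge_of_small_level hlam hlam1 hlamB hW
  have hB' : 0 ≤ oneSiteCoupling β L := oneSiteCoupling_nonneg β L
  have hlpos : 0 < luscherLambda β L := luscherLambda_pos_of_window hlam hW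
  have hlam_nn : 0 ≤ luscherLambda β L := hlpos.le
  have hl1 : luscherLambda β L ≤ 1 := by linarith [hW.2.2]
  have hLnn : (0 : ℝ) ≤ (L : ℝ) := Nat.cast_nonneg L
  have ht2 : 0 ≤ luscherLambda β L ^ 2 / L := div_nonneg (sq_nonneg _) hLnn
  have ht3 : 0 ≤ luscherLambda β L ^ 3 / (L : ℝ) ^ 2 := div_nonneg (pow_nonneg hlam_nn 3) (sq_nonneg _)
  have hlv0 : 0 ≤ levelValue su2Rep L β 0 := levelValue_su2Rep_nonneg L hβ 0
  have hCl : C * luscherLambda β L ≤ C' * luscherLambda β L := mul_le_mul_of_nonneg_right hCC' hlam_nn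
  refine ⟨w, hw, hunit, hanti, fun i l hil => (horth i l hil).trans hCl, ⟨φ, hφ, hφ1, hKφ, fun i => (hvac i).trans hCl⟩,
    fun i => ?_, fun i => ?_, fun i l hil => ?_, fun i => ?_⟩
  · exact (hres i).trans (mul_le_mul_of_nonneg_right (mul_le_mul_of_nonneg_right hCC' ht3) (sq_nonneg _))
  · obtain ⟨ha, hb⟩ := hlus i
    exact ⟨le_exp_mul_div_of_le ha ht2 (mul_nonneg (levelValue_su2Rep_nonneg 1 hB' _) hlv0) hCC',
      le_exp_mul_div_of_le hb ht2 (mul_nonneg (qform_su2Rep_self_nonneg hβ (hw i)) (levelValue_su2Rep_nonneg 1 hB' 0)) hCC'⟩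
  · exact (hcoup i l hil).trans (mul_le_mul_of_nonneg_right (mul_le_mul_of_nonneg_right hCC' ht2) hlv0)
  · have h5 : levelValue su2Rep 1 (oneSiteCoupling β L) ((i : ℕ) + 1) * levelValue su2Rep L β 0 * 1 ≤
        Real.exp (C * luscherLambda β L ^ 2 / L) *
          (qform su2Rep β (w i) (w i) * levelValue su2Rep 1 (oneSiteCoupling β L) 0) := by
      rw [mul_one]; exact (hlus i).2
    have h := spread_of_position (Nat.succ_le_of_lt i.2) hB0 hB hβ hlpos hl1 zero_le_one h5
    simpa only [mul_one] using h

/-- ★ **`OperatorPlateauAt k` from (o0)–(o6)**: the spread clause (o7) of `PlateauClauses` is implied by (o5) and the closed crux ONE.  The hypothesis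
is `OperatorPlateauAt k` with `PlateauClauses k C β u` (`u_i := ins φ O_i`) replaced by its first six conjuncts. [cite: LuscherWolff1990] -/
theorem operatorPlateauAt_of_core {k : ℕ}
    (h : ∃ C lam0 : ℝ, 0 ≤ C ∧ 0 < lam0 ∧ ∀ lam : ℝ, 0 < lam → lam ≤ lam0 → ∃ L0 : ℕ,
      ∀ (L : ℕ) [NeZero L], L0 ≤ L → ∀ β : ℝ, InFemtoWindow lam β L →
        ∃ φ : GaugeConfig 3 L SU2 → ℝ, IsPhys φ ∧ l2 φ φ = 1 ∧
          transferApply β φ = levelValue su2Rep L β 0 • φ ∧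
        ∃ u : Fin k → (GaugeConfig 3 L SU2 → ℝ), (∃ O : Fin k → (GaugeConfig 3 L SU2 → ℝ),
            (∀ i, IsPhys (O i)) ∧ u = fun i => ins φ (O i)) ∧
          (∀ i : Fin k, 0 < l2 (u i) (u i)) ∧
          (∀ i l : Fin k, i ≤ l →
            l2 (u l) (transferApply β (u l)) * l2 (u i) (u i) ≤ l2 (u i) (transferApply β (u i)) * l2 (u l) (u l)) ∧
          (∀ i l : Fin k, i ≠ l →
            |l2 (u i) (u l)| ≤ C * luscherLambda β L * (Real.sqrt (l2 (u i) (u i)) * Real.sqrt (l2 (u l) (u l)))) ∧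
          (∀ i : Fin k,
            l2 (transferApply β (u i)) (transferApply β (u i)) * l2 (u i) (u i) - l2 (u i) (transferApply β (u i)) ^ 2
              ≤ C * (luscherLambda β L ^ 3 / (L : ℝ) ^ 2) * levelValue su2Rep L β 0 ^ 2 * l2 (u i) (u i) ^ 2) ∧
          (∀ i : Fin k,
            l2 (u i) (transferApply β (u i)) * levelValue su2Rep 1 (oneSiteCoupling β L) 0 ≤
                Real.exp (C * luscherLambda β L ^ 2 / L) *
                  (levelValue su2Rep 1 (oneSiteCoupling β L) ((i : ℕ) + 1) * levelValue su2Rep L β 0) * l2 (u i) (u i) ∧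
            levelValue su2Rep 1 (oneSiteCoupling β L) ((i : ℕ) + 1) * levelValue su2Rep L β 0 * l2 (u i) (u i) ≤
                Real.exp (C * luscherLambda β L ^ 2 / L) *
                  (l2 (u i) (transferApply β (u i)) * levelValue su2Rep 1 (oneSiteCoupling β L) 0)) ∧
          (∀ i l : Fin k, i ≠ l →
            |l2 (u i) (transferApply β (u l)) -
                (l2 (u i) (transferApply β (u i)) / l2 (u i) (u i) + l2 (u l) (transferApply β (u l)) / l2 (u l) (u l)) / 2 *
                  l2 (u i) (u l)|
              ≤ C * (luscherLambda β L ^ 2 / L) * levelValue su2Rep L β 0 *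
                  (Real.sqrt (l2 (u i) (u i)) * Real.sqrt (l2 (u l) (u l))))) :
    OperatorPlateauAt k := by
  obtain ⟨C, lam0, hC0, hlam0, hC⟩ := h
  obtain ⟨B0, hB0⟩ := oneSiteLowerCoarse k 1 one_pos
  have hgk : 0 ≤ levelGap k := levelGap_nonneg k
  refine ⟨|C| + levelGap k + 1, min lam0 (min (1 / 2) (1 / (4 * max B0 1))), by positivity,
    lt_min hlam0 (lt_min (by norm_num) (by positivity)), fun lam hlam hle => ?_⟩
  obtain ⟨L0, hL⟩ := hC lam hlam (hle.trans (min_le_left _ _))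
  refine ⟨L0, fun L _ hL0 β hW => ?_⟩
  obtain ⟨φ, hφ, hφ1, hKφ, u, ⟨O, hO, rfl⟩, h0, h1, h2, h4, h5, h6⟩ := hL L hL0 β hW
  have hlam_half : lam ≤ 1 / 2 := (hle.trans (min_le_right _ _)).trans (min_le_left _ _)
  have hlam1 : lam ≤ 1 := hlam_half.trans (by norm_num)
  have hlamB : lam ≤ 1 / (4 * max B0 1) := (hle.trans (min_le_right _ _)).trans (min_le_right _ _)
  have hβ : (0 : ℝ) ≤ β := zero_le_one.trans hW.1
  have hB : B0 ≤ oneSiteCoupling β L := oneSiteCoupling_ge_of_small_level hlam hlam1 hlamB hW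
  have hlpos : 0 < luscherLambda β L := luscherLambda_pos_of_window hlam hW
  have hl1 : luscherLambda β L ≤ 1 := by linarith [hW.2.2]
  exact ⟨φ, hφ, hφ1, hKφ, O, hO, plateauClauses_of_core hB0 hB hβ hlpos hl1 h0 h1 h2 h4 h5 h6⟩

/-! ## §4 Down to item 20205 -/

/-- `DressedRitzAt k` from the excited-sector core (x1)–(x6). [cite: Luscher1983, §3] -/
theorem dressedRitzAt_of_excitedCore {k : ℕ}
    (h : ∃ C lam0 : ℝ, 0 < lam0 ∧ ∀ lam : ℝ, 0 < lam → lam ≤ lam0 → ∃ L0 : ℕ,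
      ∀ (L : ℕ) [NeZero L], L0 ≤ L → ∀ β : ℝ, InFemtoWindow lam β L →
        ∃ w : Fin k → (GaugeConfig 3 L SU2 → ℝ),
          (∀ i, IsPhys (w i)) ∧ (∀ i, l2 (w i) (w i) = 1) ∧
          (∀ i l : Fin k, i ≤ l → qform su2Rep β (w l) (w l) ≤ qform su2Rep β (w i) (w i)) ∧
          (∀ i l : Fin k, i ≠ l → |l2 (w i) (w l)| ≤ C * luscherLambda β L) ∧
          (∃ φ : GaugeConfig 3 L SU2 → ℝ, IsPhys φ ∧ l2 φ φ = 1 ∧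
              transferApply β φ = levelValue su2Rep L β 0 • φ ∧ ∀ i, |l2 φ (w i)| ≤ C * luscherLambda β L) ∧
          (∀ i, l2 (transferApply β (w i) - qform su2Rep β (w i) (w i) • w i)
              (transferApply β (w i) - qform su2Rep β (w i) (w i) • w i)
              ≤ C * (luscherLambda β L ^ 3 / (L : ℝ) ^ 2) * levelValue su2Rep L β 0 ^ 2) ∧
          (∀ i : Fin k,
            qform su2Rep β (w i) (w i) * levelValue su2Rep 1 (oneSiteCoupling β L) 0 ≤
                Real.exp (C * luscherLambda β L ^ 2 / L) *
                  (levelValue su2Rep 1 (oneSiteCoupling β L) ((i : ℕ) + 1) * levelValue su2Rep L β 0) ∧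
            levelValue su2Rep 1 (oneSiteCoupling β L) ((i : ℕ) + 1) * levelValue su2Rep L β 0 ≤
                Real.exp (C * luscherLambda β L ^ 2 / L) *
                  (qform su2Rep β (w i) (w i) * levelValue su2Rep 1 (oneSiteCoupling β L) 0)) ∧
          (∀ i l : Fin k, i ≠ l →
            |qform su2Rep β (w i) (w l) - (qform su2Rep β (w i) (w i) + qform su2Rep β (w l) (w l)) / 2 * l2 (w i) (w l)|
              ≤ C * (luscherLambda β L ^ 2 / L) * levelValue su2Rep L β 0)) :
    DressedRitzAt k :=
  dressedRitzAt_of_excitedPlateauAt (excitedPlateauAt_of_core h)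

end Summit.QuantumFields.YangMills.Theorems.FemtoTransferGap.KTGen

end
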